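import Literature.MathematicalPhysics.QuantumFieldTheory.Federbush1986.LatticeActionLimit
import Mathlib.MeasureTheory.Measure.Lebesgue.EqHaar
import Mathlib.MeasureTheory.Group.LIntegral

/-!
# `Federbush1986.LatticeActionFiniteAction` — [Federbush1986PhaseCellI] §4 p. 329 «the lattice actions S^r_0 approach the
# continuum action»: ENVELOPE-FREE.  For EVERY `C¹` potential the abelian lattice actions built from the continuum
# plaquette functional (1.13) are BOUNDED BY the continuum action at every level (Jensen) and CONVERGE to it (Fatou);
# row F1.Sect§4 for the concrete Bałaban averaging under (2.3)–(2.4) and finite action only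

statement-level skeleton of published theorems with citation tags; proofs where landed; nothing here is a claim about the Yang–Mills mass gap

CITATION HEADER.  P. Federbush, *A phase cell approach to Yang–Mills theory. I. Modes, lattice-continuum duality*, Commun.
Math. Phys. **107** (1986) 319–329 [Federbush1986PhaseCellI], §4 last sentence p. 329: *«As a final note we point out it is
straightforward to show the lattice actions S^r_0 approach the continuum action as r → ∞.»*; (1.12)–(1.14) p. 324 (the
continuum plaquette functional = the average of `∮A` over translates of the plaquette); (0.12) p. 321 (`S^r_0`).
P. Federbush, *… VI. Non-abelian lattice-continuum duality*, Ann. Inst. H. Poincaré **47** (1987) 17–23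
[Federbush1987PhaseCellVI], (10) and Theorem 2 p. 20.  Unit `lit-balaban-r17` gen 4 (fold owner of the Federbush block);
SKELETON row **F1.Sect§4** (decls of record `AbelianAveraging.LatticeActionsConvergeSummable` / `.LatticeActionsConverge`,
`AbelianModeEstimates.lean` p239224/p243344); this file sharpens `LatticeActionLimit.lean` (p250575), whose convergence
theorem needed an integrable antitone radial envelope of the field strength.

THE MATHEMATICS (ℓ = ℓ_s = 2^{−s}; `P_s(b;μ,ν) = plaqFunctional`, `F_μν = ∂_μA_ν − ∂_νA_μ`, `A ∈ C¹` arbitrary).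
(i) JENSEN.  By Green (`plaqFunctional_eq_plaqAvg`, p250575/p249483) `P_s(b;μ,ν) = ∫_{u∈[0,1]⁴}∫₀^ℓ∫₀^ℓ F_μν(ℓb+ℓu+σu_μ+τu_ν)`,
an integral of `F_μν` against a positive measure of total mass `ℓ²`; hence `P_s(b;μ,ν)² ≤ ℓ² ∫_u∫_σ∫_τ F_μν²(⋯)` (three
applications of `(∫f)² ≤ m·∫f²`, proved here by the variance identity `∫(f − c)² ≥ 0`).  (ii) TILING.  For `G ≥ 0`
continuous, `Σ_b ℓ² ∫_u∫_σ∫_τ G(ℓb+ℓu+σu_μ+τu_ν) = ∫_{ℝ⁴} G`: the `u`-integral over the unit cube is `ℓ^{−4}×` the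
integral over the lattice box `ℓb + [0,ℓ)⁴` (scaling and translation of Lebesgue measure), the boxes tile `ℝ⁴`, and the
`σ, τ`-smearing of an integral over all of `ℝ⁴` only multiplies it by `ℓ²` (Tonelli + translation invariance).  (i)+(ii):
**`S^s[P] = Σ_b Σ_{μ<ν} P_s(b;μ,ν)² ≤ ∫Σ_{μ<ν}F_μν² = contAction A` for every `s`** (in `ℝ≥0∞`, no hypothesis beyond `C¹`).
(iii) FATOU.  `S^s[P] = ∫ c_s(⌊x/ℓ_s⌋) dx` with the box densities `c_s → Σ_{μ<ν}F²` pointwise (p250575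
`tendsto_cellDensity`), so `contAction A ≤ liminf S^s[P]`; with (ii) `S^s[P] → contAction A` in `ℝ≥0∞` — also when the
action is infinite.  (iv) If the action is finite every `S^s[P]` is a convergent real series, `S^s[P] ≤ S(A)` and
`S^s[P] → S(A)`; for the concrete Bałaban averaging `axialTreeAveraging` the plaquette values of the bond assignments ARE
`P_s` under (2.3)–(2.4) (`axialTreeAveraging_plaquetteAssignmentsEq114`, p245853), which gives row F1.Sect§4 for every `C¹`
potential with (2.3)–(2.4) and finite continuum action — no decay at infinity is needed.

READING NOTE (fold owner r17).  The typed rows quantify over `IsMode c r A` alone; `IsMode` supplies `C¹` (through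
`IsConstrainedMinimizer`) but neither (2.3)–(2.4) nor finiteness of the action (gauge copies `A + dΛ`), so those two stay as
explicit binders (`…_of_mode`); relative to p250575 the decay envelope (print's Estimates 0.1–0.2) is no longer used.  The
by-product `S^s_0 ≤ S(A)` (lattice action of block-averaged data never exceeds the continuum action) is the positivity
half of lattice–continuum duality and is not displayed in print.

WHAT THIS MODULE PROVIDES (no definition, no named fact; axioms standard): `sq_integral_le_measureReal_mul_integral_sq`
(variance-trick Jensen), `sq_plaqAvg_le`, `setLIntegral_unitCube_eq_latBox` (unit-cube parametrisation of a lattice box),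
`tsum_setLIntegral_latBox` (boxes tile `ℝ⁴`), `lintegral_ofReal_smear` (Tonelli for the `σ,τ`-smearing),
`tsum_ofReal_sq_mul_plaqAvg` ((ii)), **`tsum_ofReal_plaqTermP_le`** (`S^s[P] ≤ contAction`), `tsum_ofReal_plaqTermP_eq_lintegral`,
**`tendsto_tsum_ofReal_plaqTermP`** (`S^s[P] → contAction` for every `C¹` potential), `summable_plaqTermP_of_finiteAction`,
`latticeActionP_le_toReal`, **`tendsto_latticeActionP_of_finiteAction`**, **`axialTreeAveraging_latticeActionsConverge_of_
finiteAction`**, **`axialTreeAveraging_latticeActionsConverge_of_mode`** (row F1.Sect§4 under (2.3)–(2.4) + finite action).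
-/

namespace Literature.MathematicalPhysics.QuantumFieldTheory.Federbush1986

noncomputable section

open MeasureTheory Filter Set intervalIntegral
open scoped Topology BigOperators ENNReal Interval

/-! ## §1 Jensen by the variance identity -/

/-- **`(∫ f dμ)² ≤ μ(univ) · ∫ f² dμ`** on a finite measure space (from `0 ≤ ∫ (f − c)² dμ` with `c = ∫f/μ(univ)`).
[cite: Federbush1986PhaseCellI, (1.12)–(1.14) p. 324; §4 p. 329] -/
theorem sq_integral_le_measureReal_mul_integral_sq {α : Type*} [MeasurableSpace α] {μ : Measure α} [IsFiniteMeasure μ]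
    {f : α → ℝ} (hf : Integrable f μ) (hf2 : Integrable (fun x => f x ^ 2) μ) :
    (∫ x, f x ∂μ) ^ 2 ≤ μ.real univ * ∫ x, f x ^ 2 ∂μ := by
  have key : ∀ c : ℝ, 0 ≤ (∫ x, f x ^ 2 ∂μ) - 2 * c * (∫ x, f x ∂μ) + c ^ 2 * μ.real univ := by
    intro c
    have e1 : ∫ x, (f x ^ 2 - 2 * c * f x + c ^ 2) ∂μ = (∫ x, (f x ^ 2 - 2 * c * f x) ∂μ) + ∫ _, c ^ 2 ∂μ :=
      integral_add (hf2.sub (hf.const_mul (2 * c))) (integrable_const _)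
    have e2 : ∫ x, (f x ^ 2 - 2 * c * f x) ∂μ = (∫ x, f x ^ 2 ∂μ) - ∫ x, 2 * c * f x ∂μ :=
      integral_sub hf2 (hf.const_mul (2 * c))
    have e3 : ∫ x, 2 * c * f x ∂μ = 2 * c * ∫ x, f x ∂μ := integral_const_mul _ _
    have e4 : ∫ _, c ^ 2 ∂μ = μ.real univ * c ^ 2 := by rw [MeasureTheory.integral_const, smul_eq_mul]
    have h2 : ∫ x, (f x ^ 2 - 2 * c * f x + c ^ 2) ∂μ
        = (∫ x, f x ^ 2 ∂μ) - 2 * c * (∫ x, f x ∂μ) + c ^ 2 * μ.real univ := by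
      rw [e1, e2, e3, e4]
      ring
    rw [← h2]
    exact integral_nonneg fun x => by simp only [Pi.zero_apply]; nlinarith [sq_nonneg (f x - c)]
  by_cases hm0 : μ.real univ = 0
  · have hμ : μ = 0 := Measure.measure_univ_eq_zero.mp ((measureReal_eq_zero_iff (measure_ne_top μ _)).mp hm0)
    have hI0 : ∫ x, f x ∂μ = 0 := by rw [hμ, integral_zero_measure]
    rw [hI0, hm0]
    simp
  · have hmpos : 0 < μ.real univ := lt_of_le_of_ne measureReal_nonneg (Ne.symm hm0)
    have h := key ((∫ x, f x ∂μ) / μ.real univ)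
    have h' : (∫ x, f x ^ 2 ∂μ) - 2 * ((∫ x, f x ∂μ) / μ.real univ) * (∫ x, f x ∂μ)
        + ((∫ x, f x ∂μ) / μ.real univ) ^ 2 * μ.real univ = (∫ x, f x ^ 2 ∂μ) - (∫ x, f x ∂μ) ^ 2 / μ.real univ := by
      field_simp
      ring
    rw [h'] at h
    have h3 : (∫ x, f x ∂μ) ^ 2 / μ.real univ ≤ ∫ x, f x ^ 2 ∂μ := by linarith
    have h4 := (div_le_iff₀ hmpos).1 h3
    linarith

/-- `(∫₀^ℓ f)² ≤ ℓ ∫₀^ℓ f²` for continuous `f`, `ℓ ≥ 0`. [cite: Federbush1986PhaseCellI, (1.13) p. 324] -/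
theorem sq_intervalIntegral_le {f : ℝ → ℝ} (hf : Continuous f) {ℓ : ℝ} (hℓ : 0 ≤ ℓ) :
    (∫ t in (0 : ℝ)..ℓ, f t) ^ 2 ≤ ℓ * ∫ t in (0 : ℝ)..ℓ, f t ^ 2 := by
  rw [intervalIntegral.integral_of_le hℓ, intervalIntegral.integral_of_le hℓ]
  haveI : IsFiniteMeasure (volume.restrict (Ioc (0 : ℝ) ℓ)) := isFiniteMeasure_restrict.2 measure_Ioc_lt_top.ne
  have h := sq_integral_le_measureReal_mul_integral_sq (μ := volume.restrict (Ioc (0 : ℝ) ℓ))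
    hf.integrableOn_Ioc (hf.pow 2).integrableOn_Ioc
  rwa [measureReal_restrict_apply_univ, Real.volume_real_Ioc_of_le hℓ, sub_zero] at h

/-- `vol([0,1]⁴) = 1`. [folklore] -/
private theorem volume_real_unitCube₄ : volume.real (Icc (0 : Fin 4 → ℝ) 1) = 1 := by
  rw [measureReal_def, Real.volume_Icc_pi_toReal (zero_le_one)]
  simp

/-- `(∫_{[0,1]⁴} f)² ≤ ∫_{[0,1]⁴} f²` for continuous `f`. [cite: Federbush1986PhaseCellI, (1.13) p. 324] -/
theorem sq_setIntegral_unitCube_le {f : (Fin 4 → ℝ) → ℝ} (hf : Continuous f) :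
    (∫ u in Icc (0 : Fin 4 → ℝ) 1, f u) ^ 2 ≤ ∫ u in Icc (0 : Fin 4 → ℝ) 1, f u ^ 2 := by
  haveI : IsFiniteMeasure (volume.restrict (Icc (0 : Fin 4 → ℝ) 1)) :=
    isFiniteMeasure_restrict.2 measure_Icc_lt_top.ne
  have h := sq_integral_le_measureReal_mul_integral_sq (μ := volume.restrict (Icc (0 : Fin 4 → ℝ) 1))
    (hf.continuousOn.integrableOn_compact isCompact_Icc) ((hf.pow 2).continuousOn.integrableOn_compact isCompact_Icc)
  rwa [measureReal_restrict_apply_univ, volume_real_unitCube₄, one_mul] at h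

/-! ### Continuity of the layers of `plaqAvg` (as in `LatticeActionLimit`, private there) -/

section Layers

variable {h : E4 → ℝ} (hc : Continuous h) (x : E4) (μ ν : Fin 4) (ℓ : ℝ)

/-- [folklore] -/
private theorem continuous_mkPt₄ : Continuous fun u : Fin 4 → ℝ => (mkPt u : E4) := by
  unfold mkPt; exact PiLp.continuous_toLp 2 _

include hc in
/-- `(y, σ) ↦ ∫₀^ℓ h(y + σu_μ + τu_ν) dτ` is continuous. [folklore] -/
private theorem continuous_smear₂ :
    Continuous fun q : E4 × ℝ => ∫ τ in (0 : ℝ)..ℓ, h (q.1 + q.2 • unitVec μ + τ • unitVec ν) := by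
  refine intervalIntegral.continuous_parametric_intervalIntegral_of_continuous'
    (f := fun (q : E4 × ℝ) (τ : ℝ) => h (q.1 + q.2 • unitVec μ + τ • unitVec ν)) ?_ 0 ℓ
  refine hc.comp ?_
  exact ((continuous_fst.comp continuous_fst).add ((continuous_snd.comp continuous_fst).smul continuous_const)).add
    (continuous_snd.smul continuous_const)

include hc in
/-- The `σ,τ`-smearing `y ↦ ∫₀^ℓ∫₀^ℓ h(y + σu_μ + τu_ν)` is continuous. [folklore] -/
private theorem continuous_smear₁ :
    Continuous fun y : E4 => ∫ σ in (0 : ℝ)..ℓ, ∫ τ in (0 : ℝ)..ℓ, h (y + σ • unitVec μ + τ • unitVec ν) :=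
  intervalIntegral.continuous_parametric_intervalIntegral_of_continuous'
    (f := fun (y : E4) (σ : ℝ) => ∫ τ in (0 : ℝ)..ℓ, h (y + σ • unitVec μ + τ • unitVec ν))
    (continuous_smear₂ hc μ ν ℓ) 0 ℓ

include hc in
/-- The `u`-layer `u ↦ ∫₀^ℓ∫₀^ℓ h(x + ℓu + σu_μ + τu_ν)` is continuous. [folklore] -/
private theorem continuous_layer₁ :
    Continuous fun u : Fin 4 → ℝ =>
      ∫ σ in (0 : ℝ)..ℓ, ∫ τ in (0 : ℝ)..ℓ, h (x + ℓ • mkPt u + σ • unitVec μ + τ • unitVec ν) :=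
  (continuous_smear₁ hc μ ν ℓ).comp (continuous_const.add (continuous_mkPt₄.const_smul ℓ))

include hc in
/-- For fixed `y`, `σ ↦ ∫₀^ℓ h(y + σu_μ + τu_ν) dτ` is continuous. [folklore] -/
private theorem continuous_smear₂' (y : E4) :
    Continuous fun σ : ℝ => ∫ τ in (0 : ℝ)..ℓ, h (y + σ • unitVec μ + τ • unitVec ν) :=
  (continuous_smear₂ hc μ ν ℓ).comp (continuous_const.prodMk continuous_id)

include hc in
/-- For fixed `y, σ`, `τ ↦ h(y + σu_μ + τu_ν)` is continuous. [folklore] -/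
private theorem continuous_smear₃ (y : E4) (σ : ℝ) :
    Continuous fun τ : ℝ => h (y + σ • unitVec μ + τ • unitVec ν) :=
  hc.comp (continuous_const.add (continuous_id.smul continuous_const))

end Layers

/-- **Jensen for the plaquette average**: `plaqAvg h ² ≤ ℓ² · plaqAvg (h²)` (`ℓ ≥ 0`, `h` continuous) — the averaging
measure of (1.14) has total mass `ℓ²`. [cite: Federbush1986PhaseCellI, (1.12)–(1.14) p. 324; §4 p. 329] -/
theorem sq_plaqAvg_le {h : E4 → ℝ} (hc : Continuous h) (x : E4) (μ ν : Fin 4) {ℓ : ℝ} (hℓ : 0 ≤ ℓ) :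
    plaqAvg h x μ ν ℓ ^ 2 ≤ ℓ ^ 2 * plaqAvg (fun y => h y ^ 2) x μ ν ℓ := by
  have hc2 : Continuous fun y => h y ^ 2 := hc.pow 2
  have h3 : ∀ (y : E4) (σ : ℝ), (∫ τ in (0 : ℝ)..ℓ, h (y + σ • unitVec μ + τ • unitVec ν)) ^ 2
      ≤ ℓ * ∫ τ in (0 : ℝ)..ℓ, h (y + σ • unitVec μ + τ • unitVec ν) ^ 2 :=
    fun y σ => sq_intervalIntegral_le (continuous_smear₃ hc μ ν y σ) hℓ
  have h2 : ∀ y : E4, (∫ σ in (0 : ℝ)..ℓ, ∫ τ in (0 : ℝ)..ℓ, h (y + σ • unitVec μ + τ • unitVec ν)) ^ 2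
      ≤ ℓ ^ 2 * ∫ σ in (0 : ℝ)..ℓ, ∫ τ in (0 : ℝ)..ℓ, h (y + σ • unitVec μ + τ • unitVec ν) ^ 2 := by
    intro y
    calc _ ≤ ℓ * ∫ σ in (0 : ℝ)..ℓ, (∫ τ in (0 : ℝ)..ℓ, h (y + σ • unitVec μ + τ • unitVec ν)) ^ 2 :=
          sq_intervalIntegral_le (continuous_smear₂' hc μ ν ℓ y) hℓ
      _ ≤ ℓ * ∫ σ in (0 : ℝ)..ℓ, ℓ * ∫ τ in (0 : ℝ)..ℓ, h (y + σ • unitVec μ + τ • unitVec ν) ^ 2 := by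
          refine mul_le_mul_of_nonneg_left (intervalIntegral.integral_mono_on hℓ ?_ ?_ fun σ _ => h3 y σ) hℓ
          · exact ((continuous_smear₂' hc μ ν ℓ y).pow 2).intervalIntegrable _ _
          · exact (continuous_const.mul (continuous_smear₂' hc2 μ ν ℓ y)).intervalIntegrable _ _
      _ = ℓ ^ 2 * ∫ σ in (0 : ℝ)..ℓ, ∫ τ in (0 : ℝ)..ℓ, h (y + σ • unitVec μ + τ • unitVec ν) ^ 2 := by
          rw [intervalIntegral.integral_const_mul]
          ring
  unfold plaqAvg
  calc _ ≤ ∫ u in Icc (0 : Fin 4 → ℝ) 1,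
        (∫ σ in (0 : ℝ)..ℓ, ∫ τ in (0 : ℝ)..ℓ, h (x + ℓ • mkPt u + σ • unitVec μ + τ • unitVec ν)) ^ 2 :=
        sq_setIntegral_unitCube_le (continuous_layer₁ hc x μ ν ℓ)
    _ ≤ ∫ u in Icc (0 : Fin 4 → ℝ) 1,
        ℓ ^ 2 * ∫ σ in (0 : ℝ)..ℓ, ∫ τ in (0 : ℝ)..ℓ, h (x + ℓ • mkPt u + σ • unitVec μ + τ • unitVec ν) ^ 2 := by
        refine setIntegral_mono_on ?_ ?_ measurableSet_Icc fun u _ => h2 (x + ℓ • mkPt u)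
        · exact ((continuous_layer₁ hc x μ ν ℓ).pow 2).continuousOn.integrableOn_compact isCompact_Icc
        · exact (continuous_const.mul (continuous_layer₁ hc2 x μ ν ℓ)).continuousOn.integrableOn_compact isCompact_Icc
    _ = ℓ ^ 2 * ∫ u in Icc (0 : Fin 4 → ℝ) 1,
        ∫ σ in (0 : ℝ)..ℓ, ∫ τ in (0 : ℝ)..ℓ, h (x + ℓ • mkPt u + σ • unitVec μ + τ • unitVec ν) ^ 2 :=
        integral_const_mul _ _

/-! ## §2 The unit-cube parametrisation of a lattice box; the boxes tile `ℝ⁴` -/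

/-- **`∫_{u∈[0,1]⁴} f(ℓb + ℓu) du = ℓ^{−4} ∫_{ℓb+[0,ℓ)⁴} f`** (Lebesgue integral, `f ≥ 0` measurable, `ℓ > 0`): scaling and
translation of Lebesgue measure on `ℝ⁴`, transported to `E4`. [cite: Federbush1987PhaseCellVI, (10) p. 20;
Federbush1986PhaseCellI, (1.13) p. 324] -/
theorem setLIntegral_unitCube_eq_latBox {ℓ : ℝ} (hℓ : 0 < ℓ) {f : E4 → ℝ≥0∞} (hf : Measurable f) (b : Fin 4 → ℤ) :
    ∫⁻ u in Icc (0 : Fin 4 → ℝ) 1, f (LatticeRiemann.cornerPt ℓ b + ℓ • mkPt u)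
      = (ENNReal.ofReal (ℓ ^ 4))⁻¹ * ∫⁻ y in LatticeRiemann.latBox ℓ b, f y := by
  -- notation on `ℝ⁴ = Fin 4 → ℝ`
  set c : Fin 4 → ℝ := fun i => ℓ * (b i : ℝ) with hc
  set S : Set (Fin 4 → ℝ) := Set.univ.pi fun i => Ico (ℓ * (b i : ℝ)) (ℓ * ((b i : ℝ) + 1)) with hS
  set T : Set (Fin 4 → ℝ) := Set.univ.pi fun _ => Ico (0 : ℝ) 1 with hT
  set F : (Fin 4 → ℝ) → ℝ≥0∞ := fun v => f (mkPt v) with hF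
  have hSm : MeasurableSet S := MeasurableSet.univ_pi fun _ => measurableSet_Ico
  have hTm : MeasurableSet T := MeasurableSet.univ_pi fun _ => measurableSet_Ico
  have hFm : Measurable F := hf.comp continuous_mkPt₄.measurable
  -- the right-hand side on `ℝ⁴`
  have hR : ∫⁻ y in LatticeRiemann.latBox ℓ b, f y = ∫⁻ v in S, F v := by
    rw [LatticeRiemann.latBox_eq_preimage]
    have h := (PiLp.volume_preserving_ofLp (Fin 4)).setLIntegral_comp_preimage (μ := volume) (ν := volume) hSm hFm
    simpa [F, mkPt] using h
  -- the left-hand side on `ℝ⁴`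
  have hpt : ∀ u : Fin 4 → ℝ, LatticeRiemann.cornerPt ℓ b + ℓ • mkPt u = mkPt (c + ℓ • u) := by
    intro u
    unfold LatticeRiemann.cornerPt mkPt
    rw [WithLp.toLp_add, WithLp.toLp_smul]
  have hTae : (T : Set (Fin 4 → ℝ)) =ᵐ[volume] Icc (0 : Fin 4 → ℝ) 1 := by
    rw [volume_pi]
    exact Measure.univ_pi_Ico_ae_eq_Icc
  have hmem : ∀ u : Fin 4 → ℝ, c + ℓ • u ∈ S ↔ u ∈ T := by
    intro u
    simp only [S, T, c, Set.mem_univ_pi, Set.mem_Ico, Pi.add_apply, Pi.smul_apply, smul_eq_mul]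
    refine forall_congr' fun i => ?_
    constructor
    · rintro ⟨h1, h2⟩
      constructor <;> nlinarith
    · rintro ⟨h1, h2⟩
      constructor <;> nlinarith
  have hind : ∀ u : Fin 4 → ℝ, T.indicator (fun u => F (c + ℓ • u)) u = S.indicator F (c + ℓ • u) := by
    intro u
    by_cases hu : u ∈ T
    · rw [indicator_of_mem hu, indicator_of_mem ((hmem u).2 hu)]
    · rw [indicator_of_notMem hu, indicator_of_notMem (fun h => hu ((hmem u).1 h))]
  -- `H v = 𝟙_S F (c + v)`
  have hHm : Measurable fun v : Fin 4 → ℝ => S.indicator F (c + v) := (hFm.indicator hSm).comp (measurable_const_add c)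
  have hscale : ∫⁻ u : Fin 4 → ℝ, S.indicator F (c + ℓ • u)
      = (ENNReal.ofReal (ℓ ^ 4))⁻¹ * ∫⁻ v : Fin 4 → ℝ, S.indicator F (c + v) := by
    have h1 := lintegral_map (μ := (volume : Measure (Fin 4 → ℝ))) hHm (measurable_const_smul ℓ)
    -- h1 : ∫⁻ a, H a ∂(map (ℓ • ·) volume) = ∫⁻ u, H (ℓ • u)
    rw [← h1, Measure.map_addHaar_smul volume hℓ.ne', lintegral_smul_measure, Module.finrank_fin_fun,
      abs_of_pos (inv_pos.2 (pow_pos hℓ 4)), ENNReal.ofReal_inv_of_pos (pow_pos hℓ 4)]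
    rfl
  calc ∫⁻ u in Icc (0 : Fin 4 → ℝ) 1, f (LatticeRiemann.cornerPt ℓ b + ℓ • mkPt u)
      = ∫⁻ u in Icc (0 : Fin 4 → ℝ) 1, F (c + ℓ • u) := by simp_rw [hpt]; rfl
    _ = ∫⁻ u in T, F (c + ℓ • u) := setLIntegral_congr hTae.symm
    _ = ∫⁻ u, T.indicator (fun u => F (c + ℓ • u)) u := (lintegral_indicator hTm _).symm
    _ = ∫⁻ u, S.indicator F (c + ℓ • u) := lintegral_congr hind
    _ = (ENNReal.ofReal (ℓ ^ 4))⁻¹ * ∫⁻ v : Fin 4 → ℝ, S.indicator F (c + v) := hscale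
    _ = (ENNReal.ofReal (ℓ ^ 4))⁻¹ * ∫⁻ v : Fin 4 → ℝ, S.indicator F v := by
        rw [lintegral_add_left_eq_self (μ := (volume : Measure (Fin 4 → ℝ))) (S.indicator F) c]
    _ = (ENNReal.ofReal (ℓ ^ 4))⁻¹ * ∫⁻ v in S, F v := by rw [lintegral_indicator hSm]
    _ = (ENNReal.ofReal (ℓ ^ 4))⁻¹ * ∫⁻ y in LatticeRiemann.latBox ℓ b, f y := by rw [hR]

/-- **The lattice boxes tile `ℝ⁴`**: `Σ_b ∫_{ℓb+[0,ℓ)⁴} f = ∫ f` (Lebesgue integral, `ℓ > 0`). [cite: Federbush1987PhaseCellVI,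
(10) p. 20] -/
theorem tsum_setLIntegral_latBox {ℓ : ℝ} (hℓ : 0 < ℓ) (f : E4 → ℝ≥0∞) :
    ∑' b : Fin 4 → ℤ, ∫⁻ y in LatticeRiemann.latBox ℓ b, f y = ∫⁻ y, f y := by
  have hd : Pairwise (Function.onFun Disjoint fun b : Fin 4 → ℤ => LatticeRiemann.latBox ℓ b) := by
    intro b b' hne
    refine Set.disjoint_left.2 fun x hx hx' => hne ?_
    rw [LatticeRiemann.mem_latBox_iff hℓ] at hx hx'
    exact hx.symm.trans hx'
  have hU : (⋃ b : Fin 4 → ℤ, LatticeRiemann.latBox ℓ b) = univ :=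
    Set.iUnion_eq_univ_iff.2 fun x => ⟨LatticeRiemann.floorIdx ℓ x, (LatticeRiemann.mem_latBox_iff hℓ).2 rfl⟩
  rw [← lintegral_iUnion (fun _ => LatticeRiemann.measurableSet_latBox) hd f, hU, Measure.restrict_univ]

/-! ## §3 Tonelli for the `σ, τ`-smearing -/

/-- **`∫_{ℝ⁴} ∫₀^ℓ∫₀^ℓ G(y + σu_μ + τu_ν) dτ dσ dy = ℓ² ∫_{ℝ⁴} G`** for continuous `G ≥ 0` (Tonelli and translation
invariance; Lebesgue integrals). [cite: Federbush1986PhaseCellI, (1.13)–(1.14) p. 324] -/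
theorem lintegral_ofReal_smear {G : E4 → ℝ} (hG : Continuous G) (hG0 : ∀ y, 0 ≤ G y) {ℓ : ℝ} (hℓ : 0 ≤ ℓ)
    (μ ν : Fin 4) :
    ∫⁻ y, ENNReal.ofReal (∫ σ in (0 : ℝ)..ℓ, ∫ τ in (0 : ℝ)..ℓ, G (y + σ • unitVec μ + τ • unitVec ν))
      = ENNReal.ofReal (ℓ ^ 2) * ∫⁻ y, ENNReal.ofReal (G y) := by
  have hin : ∀ (y : E4) (σ : ℝ), ENNReal.ofReal (∫ τ in (0 : ℝ)..ℓ, G (y + σ • unitVec μ + τ • unitVec ν))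
      = ∫⁻ τ in Ioc (0 : ℝ) ℓ, ENNReal.ofReal (G (y + σ • unitVec μ + τ • unitVec ν)) := by
    intro y σ
    rw [intervalIntegral.integral_of_le hℓ]
    exact ofReal_integral_eq_lintegral_ofReal (continuous_smear₃ hG μ ν y σ).integrableOn_Ioc
      (ae_of_all _ fun τ => hG0 _)
  have hmid : ∀ y : E4, ENNReal.ofReal (∫ σ in (0 : ℝ)..ℓ, ∫ τ in (0 : ℝ)..ℓ, G (y + σ • unitVec μ + τ • unitVec ν))
      = ∫⁻ σ in Ioc (0 : ℝ) ℓ, ∫⁻ τ in Ioc (0 : ℝ) ℓ, ENNReal.ofReal (G (y + σ • unitVec μ + τ • unitVec ν)) := by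
    intro y
    rw [intervalIntegral.integral_of_le hℓ, ofReal_integral_eq_lintegral_ofReal
      (continuous_smear₂' hG μ ν ℓ y).integrableOn_Ioc
      (ae_of_all _ fun σ => intervalIntegral.integral_nonneg hℓ fun τ _ => hG0 _)]
    exact lintegral_congr fun σ => hin y σ
  simp_rw [hmid]
  -- swap `y` with `σ`
  have hmeas3 : Measurable fun p : (E4 × ℝ) × ℝ =>
      ENNReal.ofReal (G (p.1.1 + p.1.2 • unitVec μ + p.2 • unitVec ν)) := by
    refine (ENNReal.continuous_ofReal.comp (hG.comp ?_)).measurable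
    exact ((continuous_fst.comp continuous_fst).add ((continuous_snd.comp continuous_fst).smul continuous_const)).add
      (continuous_snd.smul continuous_const)
  have hae1 : AEMeasurable (Function.uncurry fun (y : E4) (σ : ℝ) =>
      ∫⁻ τ in Ioc (0 : ℝ) ℓ, ENNReal.ofReal (G (y + σ • unitVec μ + τ • unitVec ν)))
      ((volume : Measure E4).prod (volume.restrict (Ioc (0 : ℝ) ℓ))) :=
    (Measurable.lintegral_prod_right' (ν := volume.restrict (Ioc (0 : ℝ) ℓ)) hmeas3).aemeasurable
  rw [lintegral_lintegral_swap hae1]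
  have hswap2 : ∀ σ : ℝ, ∫⁻ y : E4, ∫⁻ τ in Ioc (0 : ℝ) ℓ, ENNReal.ofReal (G (y + σ • unitVec μ + τ • unitVec ν))
      = ∫⁻ τ in Ioc (0 : ℝ) ℓ, ∫⁻ y : E4, ENNReal.ofReal (G (y + σ • unitVec μ + τ • unitVec ν)) := by
    intro σ
    refine lintegral_lintegral_swap ?_
    refine (ENNReal.continuous_ofReal.comp (hG.comp ?_)).measurable.aemeasurable
    exact (continuous_fst.add continuous_const).add (continuous_snd.smul continuous_const)
  simp_rw [hswap2]
  have htr : ∀ σ τ : ℝ, ∫⁻ y : E4, ENNReal.ofReal (G (y + σ • unitVec μ + τ • unitVec ν))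
      = ∫⁻ y : E4, ENNReal.ofReal (G y) := by
    intro σ τ
    have := lintegral_add_right_eq_self (μ := (volume : Measure E4)) (fun y => ENNReal.ofReal (G y))
      (σ • unitVec μ + τ • unitVec ν)
    simpa only [add_assoc] using this
  simp_rw [htr]
  rw [setLIntegral_const, setLIntegral_const, Real.volume_Ioc, sub_zero, ENNReal.ofReal_pow hℓ]
  ring

/-! ## §4 `S^s[P] ≤ contAction A` (Jensen + tiling) -/

/-- Plaquette sums as base-point sums in `ℝ≥0∞`: `Σ_p φ(p) = Σ_b Σ_{μ,ν} φ(b;μ,ν)`. [cite: Federbush1986PhaseCellI, (0.12)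
p. 321, Fig. 4 p. 324] -/
theorem tsum_plaq_eq_tsum_base_ennreal {s : ℕ} (φ : Plaq s → ℝ≥0∞) :
    ∑' p, φ p = ∑' b : Fin 4 → ℤ, ∑ μ : Fin 4, ∑ ν : Fin 4, φ ⟨b, μ, ν⟩ := by
  rw [← (Plaq.equivProd s).tsum_eq φ, ENNReal.tsum_prod']
  refine tsum_congr fun b => ?_
  rw [tsum_fintype, Fintype.sum_prod_type]
  rfl

/-- **(ii) TILING**: for continuous `G ≥ 0`, `Σ_b ℓ_s² · plaqAvg G (ℓ_s b) = ∫_{ℝ⁴} G` (in `ℝ≥0∞`).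
[cite: Federbush1986PhaseCellI, (1.12)–(1.14) p. 324; Federbush1987PhaseCellVI, (10) p. 20] -/
theorem tsum_ofReal_sq_mul_plaqAvg {G : E4 → ℝ} (hG : Continuous G) (hG0 : ∀ y, 0 ≤ G y) (s : ℕ) (μ ν : Fin 4) :
    ∑' b : Fin 4 → ℤ, ENNReal.ofReal
        (latLen s ^ 2 * plaqAvg G (LatticeRiemann.cornerPt (latLen s) b) μ ν (latLen s))
      = ∫⁻ y, ENNReal.ofReal (G y) := by
  have hℓ : 0 < latLen s := latLen_pos s
  -- the smeared function `g`
  have hg0 : ∀ y : E4, 0 ≤ ∫ σ in (0 : ℝ)..latLen s, ∫ τ in (0 : ℝ)..latLen s, G (y + σ • unitVec μ + τ • unitVec ν) :=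
    fun y => intervalIntegral.integral_nonneg hℓ.le fun σ _ =>
      intervalIntegral.integral_nonneg hℓ.le fun τ _ => hG0 _
  have hgc := continuous_smear₁ hG μ ν (latLen s)
  have hterm : ∀ b : Fin 4 → ℤ,
      ENNReal.ofReal (latLen s ^ 2 * plaqAvg G (LatticeRiemann.cornerPt (latLen s) b) μ ν (latLen s))
        = ENNReal.ofReal (latLen s ^ 2) * ((ENNReal.ofReal (latLen s ^ 4))⁻¹ *
          ∫⁻ y in LatticeRiemann.latBox (latLen s) b, ENNReal.ofReal
            (∫ σ in (0 : ℝ)..latLen s, ∫ τ in (0 : ℝ)..latLen s, G (y + σ • unitVec μ + τ • unitVec ν))) := by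
    intro b
    rw [ENNReal.ofReal_mul (sq_nonneg _)]
    congr 1
    unfold plaqAvg
    rw [ofReal_integral_eq_lintegral_ofReal
      ((continuous_layer₁ hG _ μ ν (latLen s)).continuousOn.integrableOn_compact isCompact_Icc)
      (ae_of_all _ fun u => hg0 _)]
    exact setLIntegral_unitCube_eq_latBox hℓ (ENNReal.measurable_ofReal.comp hgc.measurable) b
  rw [tsum_congr hterm, ENNReal.tsum_mul_left, ENNReal.tsum_mul_left, tsum_setLIntegral_latBox hℓ,
    lintegral_ofReal_smear hG hG0 hℓ.le μ ν]
  have h4 : ENNReal.ofReal (latLen s ^ 4) = ENNReal.ofReal (latLen s ^ 2) * ENNReal.ofReal (latLen s ^ 2) := by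
    rw [← ENNReal.ofReal_mul (sq_nonneg _)]
    ring_nf
  have hne0 : ENNReal.ofReal (latLen s ^ 4) ≠ 0 := (ENNReal.ofReal_pos.2 (by positivity)).ne'
  have hneT : ENNReal.ofReal (latLen s ^ 4) ≠ ⊤ := ENNReal.ofReal_ne_top
  calc ENNReal.ofReal (latLen s ^ 2) * ((ENNReal.ofReal (latLen s ^ 4))⁻¹ *
        (ENNReal.ofReal (latLen s ^ 2) * ∫⁻ y, ENNReal.ofReal (G y)))
      = (ENNReal.ofReal (latLen s ^ 2) * ENNReal.ofReal (latLen s ^ 2)) * (ENNReal.ofReal (latLen s ^ 4))⁻¹ *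
          ∫⁻ y, ENNReal.ofReal (G y) := by ring
    _ = ∫⁻ y, ENNReal.ofReal (G y) := by rw [← h4, ENNReal.mul_inv_cancel hne0 hneT, one_mul]

/-- `∫⁻ Σ_{μ<ν} F² = Σ_{μ<ν} ∫⁻ F²`. [cite: Federbush1986PhaseCellI, §0 p. 320] -/
theorem lintegral_ofReal_actionDensity {A : E4 → Fin 4 → ℝ} (hA : ContDiff ℝ 1 A) :
    ∫⁻ y, ENNReal.ofReal (actionDensity A y)
      = ∑ μ : Fin 4, ∑ ν : Fin 4,
        (if μ < ν then ∫⁻ y, ENNReal.ofReal (fieldStrength A μ ν y ^ 2) else 0) := by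
  have hmeas : ∀ μ ν : Fin 4,
      Measurable fun y : E4 => ENNReal.ofReal (if μ < ν then fieldStrength A μ ν y ^ 2 else 0) := by
    intro μ ν
    by_cases h : μ < ν
    · simp only [h, ↓reduceIte]
      exact ENNReal.measurable_ofReal.comp ((continuous_fieldStrength hA μ ν).pow 2).measurable
    · simp only [h, ↓reduceIte, ENNReal.ofReal_zero]
      exact measurable_const
  have h1 : ∀ y : E4, ENNReal.ofReal (actionDensity A y)
      = ∑ μ : Fin 4, ∑ ν : Fin 4, ENNReal.ofReal (if μ < ν then fieldStrength A μ ν y ^ 2 else 0) := by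
    intro y
    unfold actionDensity
    rw [ENNReal.ofReal_sum_of_nonneg (fun μ _ => Finset.sum_nonneg fun ν _ => by split_ifs <;> positivity)]
    exact Finset.sum_congr rfl fun μ _ => ENNReal.ofReal_sum_of_nonneg fun ν _ => by split_ifs <;> positivity
  simp_rw [h1]
  rw [lintegral_finsetSum _ (fun μ _ => Finset.measurable_sum _ fun ν _ => hmeas μ ν)]
  refine Finset.sum_congr rfl fun μ _ => ?_
  rw [lintegral_finsetSum _ (fun ν _ => hmeas μ ν)]
  refine Finset.sum_congr rfl fun ν _ => ?_
  by_cases h : μ < ν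
  · simp only [h, ↓reduceIte]
  · simp only [h, ↓reduceIte, ENNReal.ofReal_zero, lintegral_zero]

/-- **`S^s[P] ≤ contAction A` for every level `s` and every `C¹` potential** (in `ℝ≥0∞`): the lattice action of the
continuum plaquette functional never exceeds the continuum action (Jensen + tiling). [cite: Federbush1986PhaseCellI, (0.12)
p. 321, (1.13) p. 324, §4 p. 329] -/
theorem tsum_ofReal_plaqTermP_le {A : E4 → Fin 4 → ℝ} (hA : ContDiff ℝ 1 A) (s : ℕ) :
    ∑' p : Plaq s, ENNReal.ofReal (plaqTermP s A p) ≤ contAction A := by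
  have hℓ := latLen_pos s
  set T : Fin 4 → Fin 4 → (Fin 4 → ℤ) → ℝ≥0∞ := fun μ ν b =>
    if μ < ν then ENNReal.ofReal (latLen s ^ 2 *
      plaqAvg (fun y => fieldStrength A μ ν y ^ 2) (LatticeRiemann.cornerPt (latLen s) b) μ ν (latLen s)) else 0
    with hTdef
  have hpt : ∀ (b : Fin 4 → ℤ) (μ ν : Fin 4), ENNReal.ofReal (plaqTermP s A ⟨b, μ, ν⟩) ≤ T μ ν b := by
    intro b μ ν
    by_cases h : μ < ν
    · simp only [plaqTermP, T, h, ↓reduceIte]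
      refine ENNReal.ofReal_le_ofReal ?_
      rw [plaqFunctional_eq_plaqAvg hA, Plaq.src_eq_cornerPt]
      exact sq_plaqAvg_le (continuous_fieldStrength hA μ ν) _ μ ν hℓ.le
    · simp only [plaqTermP, T, h, ↓reduceIte, ENNReal.ofReal_zero, le_refl]
  have hT : ∀ μ ν : Fin 4, ∑' b, T μ ν b
      = if μ < ν then ∫⁻ y, ENNReal.ofReal (fieldStrength A μ ν y ^ 2) else 0 := by
    intro μ ν
    by_cases h : μ < ν
    · simp only [T, h, ↓reduceIte]
      exact tsum_ofReal_sq_mul_plaqAvg ((continuous_fieldStrength hA μ ν).pow 2) (fun y => sq_nonneg _) s μ ν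
    · simp only [T, h, ↓reduceIte, tsum_zero]
  calc ∑' p : Plaq s, ENNReal.ofReal (plaqTermP s A p)
      = ∑' b : Fin 4 → ℤ, ∑ μ : Fin 4, ∑ ν : Fin 4, ENNReal.ofReal (plaqTermP s A ⟨b, μ, ν⟩) :=
        tsum_plaq_eq_tsum_base_ennreal _
    _ ≤ ∑' b : Fin 4 → ℤ, ∑ μ : Fin 4, ∑ ν : Fin 4, T μ ν b :=
        ENNReal.tsum_le_tsum fun b => Finset.sum_le_sum fun μ _ => Finset.sum_le_sum fun ν _ => hpt b μ ν
    _ = ∑ μ : Fin 4, ∑ ν : Fin 4, ∑' b : Fin 4 → ℤ, T μ ν b := by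
        rw [Summable.tsum_finsetSum (fun _ _ => ENNReal.summable)]
        exact Finset.sum_congr rfl fun μ _ => Summable.tsum_finsetSum fun _ _ => ENNReal.summable
    _ = ∑ μ : Fin 4, ∑ ν : Fin 4, (if μ < ν then ∫⁻ y, ENNReal.ofReal (fieldStrength A μ ν y ^ 2) else 0) := by
        simp_rw [hT]
    _ = contAction A := by rw [← lintegral_ofReal_actionDensity hA, contAction_eq_lintegral_actionDensity]

/-! ## §5 Fatou: `contAction A ≤ liminf S^s[P]`, hence `S^s[P] → contAction A` -/

/-- `S^s[P] = ∫ c_s(⌊x/ℓ_s⌋) dx` in `ℝ≥0∞` (the plaquette sum as the integral of the box-step density).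
[cite: Federbush1987PhaseCellVI, (10) p. 20; Federbush1986PhaseCellI, §4 p. 329] -/
theorem tsum_ofReal_plaqTermP_eq_lintegral (A : E4 → Fin 4 → ℝ) (s : ℕ) :
    ∑' p : Plaq s, ENNReal.ofReal (plaqTermP s A p)
      = ∫⁻ x, ENNReal.ofReal (cellDensity s A (LatticeRiemann.floorIdx (latLen s) x)) := by
  have h1 := LatticeRiemann.lintegral_enorm_stepFun (c := cellDensity s A) (latLen_pos s)
  have h2 : ∀ x : E4, ‖LatticeRiemann.stepFun (latLen s) (cellDensity s A) x‖ₑ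
      = ENNReal.ofReal (cellDensity s A (LatticeRiemann.floorIdx (latLen s) x)) :=
    fun x => Real.enorm_of_nonneg (cellDensity_nonneg s A _)
  simp_rw [h2] at h1
  rw [h1, tsum_plaq_eq_tsum_base_ennreal]
  refine tsum_congr fun b => ?_
  rw [Real.enorm_of_nonneg (cellDensity_nonneg s A b), ← ENNReal.ofReal_mul (cellDensity_nonneg s A b),
    mul_comm (cellDensity s A b), latLen_pow_mul_cellDensity,
    ENNReal.ofReal_sum_of_nonneg (fun μ _ => Finset.sum_nonneg fun ν _ => plaqTermP_nonneg s A _)]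
  refine Finset.sum_congr rfl fun μ _ => ?_
  rw [ENNReal.ofReal_sum_of_nonneg (fun ν _ => plaqTermP_nonneg s A _)]

/-- **FATOU**: `contAction A ≤ liminf_s S^s[P]` for every `C¹` potential. [cite: Federbush1986PhaseCellI, §4 p. 329;
Federbush1987PhaseCellVI, Theorem 2 p. 20] -/
theorem contAction_le_liminf_tsum_ofReal_plaqTermP {A : E4 → Fin 4 → ℝ} (hA : ContDiff ℝ 1 A) :
    contAction A ≤ liminf (fun s => ∑' p : Plaq s, ENNReal.ofReal (plaqTermP s A p)) atTop := by
  have hmeas : ∀ s : ℕ, AEMeasurable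
      (fun x : E4 => ENNReal.ofReal (cellDensity s A (LatticeRiemann.floorIdx (latLen s) x))) volume :=
    fun s => (LatticeRiemann.measurable_stepFun (ℓ := latLen s) (c := cellDensity s A)).ennreal_ofReal.aemeasurable
  have hF := lintegral_liminf_le' (μ := (volume : Measure E4)) (u := atTop) hmeas
  have hlim : ∀ x : E4, liminf (fun s => ENNReal.ofReal (cellDensity s A (LatticeRiemann.floorIdx (latLen s) x))) atTop
      = ENNReal.ofReal (actionDensity A x) :=
    fun x => ((ENNReal.continuous_ofReal.tendsto _).comp (tendsto_cellDensity hA x)).liminf_eq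
  simp_rw [hlim] at hF
  rw [contAction_eq_lintegral_actionDensity]
  refine hF.trans_eq (liminf_congr (Eventually.of_forall fun s => ?_))
  exact (tsum_ofReal_plaqTermP_eq_lintegral A s).symm

/-- **«The lattice actions S^r_0 approach the continuum action as r → ∞» for EVERY `C¹` potential** (in `ℝ≥0∞`, lattice
action built from the continuum plaquette functional (1.13); the limit is `+∞` exactly when the action is infinite).
[cite: Federbush1986PhaseCellI, §4 p. 329; Federbush1987PhaseCellVI, Theorem 2 p. 20] -/
theorem tendsto_tsum_ofReal_plaqTermP {A : E4 → Fin 4 → ℝ} (hA : ContDiff ℝ 1 A) :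
    Tendsto (fun s => ∑' p : Plaq s, ENNReal.ofReal (plaqTermP s A p)) atTop (𝓝 (contAction A)) :=
  tendsto_of_le_liminf_of_limsup_le (contAction_le_liminf_tsum_ofReal_plaqTermP hA)
    (limsup_le_of_le (h := Eventually.of_forall fun s => tsum_ofReal_plaqTermP_le hA s))

/-! ## §6 Finite action: real series, `S^s[P] ≤ S(A)`, `S^s[P] → S(A)` -/

/-- With finite continuum action every level's plaquette series `S^s[P]` converges. [cite: Federbush1986PhaseCellI, (0.12)
p. 321, §4 p. 329] -/
theorem summable_plaqTermP_of_finiteAction {A : E4 → Fin 4 → ℝ} (hA : ContDiff ℝ 1 A) (hfin : contAction A ≠ ⊤)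
    (s : ℕ) : Summable (plaqTermP s A) := by
  refine Summable.of_enorm (ne_top_of_le_ne_top hfin ?_)
  have h : ∀ p : Plaq s, ‖plaqTermP s A p‖ₑ = ENNReal.ofReal (plaqTermP s A p) :=
    fun p => Real.enorm_of_nonneg (plaqTermP_nonneg s A p)
  simp_rw [h]
  exact tsum_ofReal_plaqTermP_le hA s

/-- With finite action, `ofReal S^s[P] = Σ_p ofReal P²`. [cite: Federbush1986PhaseCellI, (0.12) p. 321] -/
theorem ofReal_latticeActionP_eq {A : E4 → Fin 4 → ℝ} (hA : ContDiff ℝ 1 A) (hfin : contAction A ≠ ⊤) (s : ℕ) :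
    ENNReal.ofReal (latticeActionP s A) = ∑' p : Plaq s, ENNReal.ofReal (plaqTermP s A p) :=
  ENNReal.ofReal_tsum_of_nonneg (plaqTermP_nonneg s A) (summable_plaqTermP_of_finiteAction hA hfin s)

/-- **`S^s[P] ≤ S(A)`** at every level (finite action). [cite: Federbush1986PhaseCellI, §4 p. 329] -/
theorem latticeActionP_le_toReal {A : E4 → Fin 4 → ℝ} (hA : ContDiff ℝ 1 A) (hfin : contAction A ≠ ⊤) (s : ℕ) :
    latticeActionP s A ≤ (contAction A).toReal := by
  rw [← ENNReal.ofReal_le_iff_le_toReal hfin, ofReal_latticeActionP_eq hA hfin s]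
  exact tsum_ofReal_plaqTermP_le hA s

/-- **`S^s[P] → contAction A`** (finite action, in `ℝ≥0∞`). [cite: Federbush1986PhaseCellI, §4 p. 329;
Federbush1987PhaseCellVI, Theorem 2 p. 20] -/
theorem tendsto_latticeActionP_of_finiteAction {A : E4 → Fin 4 → ℝ} (hA : ContDiff ℝ 1 A)
    (hfin : contAction A ≠ ⊤) :
    Tendsto (fun s => ENNReal.ofReal (latticeActionP s A)) atTop (𝓝 (contAction A)) :=
  (tendsto_tsum_ofReal_plaqTermP hA).congr fun s => (ofReal_latticeActionP_eq hA hfin s).symm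

/-- **`S^s[P] → S(A)`** as real numbers (finite action). [cite: Federbush1986PhaseCellI, §4 p. 329] -/
theorem tendsto_latticeActionP_toReal {A : E4 → Fin 4 → ℝ} (hA : ContDiff ℝ 1 A) (hfin : contAction A ≠ ⊤) :
    Tendsto (fun s => latticeActionP s A) atTop (𝓝 (contAction A).toReal) := by
  have h := (ENNReal.tendsto_toReal hfin).comp (tendsto_latticeActionP_of_finiteAction hA hfin)
  refine h.congr fun s => ?_
  simp only [Function.comp_apply]
  exact ENNReal.toReal_ofReal (tsum_nonneg (plaqTermP_nonneg s A))

/-! ## §7 Row F1.Sect§4 for the concrete Bałaban averaging: (2.3)–(2.4) and finite action suffice -/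

/-- For the concrete averaging with the axial trees and every `C¹` potential with (2.3)–(2.4): the `ℝ≥0∞` Wilson actions
`Σ_p [μ<ν] A_{∂p}²` of the bond assignments (2.12) are bounded by the continuum action at every level and converge to it —
no decay and no finiteness hypothesis. [cite: Federbush1986PhaseCellI, (1.14) p. 324, §2 p. 325, §4 p. 329] -/
theorem axialTreeAveraging_tsum_ofReal_plaqTerm {A : E4 → Fin 4 → ℝ} {B₁ B₂ : ℝ} (hA : ContDiff ℝ 1 A)
    (hB₁ : ∀ x μ, |A x μ| ≤ B₁) (hB₂ : ∀ x ν μ, |pd A ν μ x| ≤ B₂) :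
    (∀ s, ∑' p : Plaq s, ENNReal.ofReal (AbelianAveraging.plaqTerm s (axialTreeAveraging.bond s A) p) ≤ contAction A) ∧
      Tendsto (fun s => ∑' p : Plaq s, ENNReal.ofReal (AbelianAveraging.plaqTerm s (axialTreeAveraging.bond s A) p))
        atTop (𝓝 (contAction A)) := by
  have h : ∀ s, AbelianAveraging.plaqTerm s (axialTreeAveraging.bond s A) = plaqTermP s A :=
    fun s => (axialTreeAveraging_plaqTerm_eq hA hB₁ hB₂ s).1
  simp_rw [h]
  exact ⟨tsum_ofReal_plaqTermP_le hA, tendsto_tsum_ofReal_plaqTermP hA⟩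

/-- **Row F1.Sect§4, concrete averaging, finite action.**  For the Bałaban averaging with the axial trees and every `C¹`
potential with (2.3)–(2.4) and finite continuum action: every level's Wilson action `S^s_0` of the bond assignments (2.12) is
a convergent series and `S^s_0 → contAction A` — the conclusion of `LatticeActionsConvergeSummable`, with no decay hypothesis.
[cite: Federbush1986PhaseCellI, §4 p. 329] -/
theorem axialTreeAveraging_latticeActionsConverge_of_finiteAction {A : E4 → Fin 4 → ℝ} {B₁ B₂ : ℝ}
    (hA : ContDiff ℝ 1 A) (hB₁ : ∀ x μ, |A x μ| ≤ B₁) (hB₂ : ∀ x ν μ, |pd A ν μ x| ≤ B₂)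
    (hfin : contAction A ≠ ⊤) :
    (∀ s, Summable (AbelianAveraging.plaqTerm s (axialTreeAveraging.bond s A))) ∧
      Tendsto (fun s => ENNReal.ofReal (AbelianAveraging.latticeAction s (axialTreeAveraging.bond s A))) atTop
        (𝓝 (contAction A)) := by
  refine ⟨fun s => ?_, ?_⟩
  · rw [(axialTreeAveraging_plaqTerm_eq hA hB₁ hB₂ s).1]
    exact summable_plaqTermP_of_finiteAction hA hfin s
  · have : (fun s => ENNReal.ofReal (AbelianAveraging.latticeAction s (axialTreeAveraging.bond s A)))
        = fun s => ENNReal.ofReal (latticeActionP s A) :=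
      funext fun s => by rw [(axialTreeAveraging_plaqTerm_eq hA hB₁ hB₂ s).2]
    rw [this]
    exact tendsto_latticeActionP_of_finiteAction hA hfin

/-- **Row F1.Sect§4 for a MODE of the concrete averaging** (`IsMode` supplies `C¹`), under (2.3)–(2.4) and finite action:
the conclusion of `axialTreeAveraging.LatticeActionsConvergeSummable`. [cite: Federbush1986PhaseCellI, §3 (3.1) p. 326–327,
§4 p. 329] -/
theorem axialTreeAveraging_latticeActionsConverge_of_mode {A : E4 → Fin 4 → ℝ} {c₀ : ℝ} {r : ℕ} {B₁ B₂ : ℝ}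
    (hm : axialTreeAveraging.IsMode c₀ r A) (hB₁ : ∀ x μ, |A x μ| ≤ B₁) (hB₂ : ∀ x ν μ, |pd A ν μ x| ≤ B₂)
    (hfin : contAction A ≠ ⊤) :
    (∀ s, Summable (AbelianAveraging.plaqTerm s (axialTreeAveraging.bond s A))) ∧
      Tendsto (fun s => ENNReal.ofReal (AbelianAveraging.latticeAction s (axialTreeAveraging.bond s A))) atTop
        (𝓝 (contAction A)) := by
  obtain ⟨_, _, hmin⟩ := hm
  exact axialTreeAveraging_latticeActionsConverge_of_finiteAction hmin.1 hB₁ hB₂ hfin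

end

end Literature.MathematicalPhysics.QuantumFieldTheory.Federbush1986
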